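import Mathlib
import Literature.LinearAlgebra.Matrix.VarahBound
import Literature.Analysis.InnerProduct.SubspaceResidualClusterBound
import HarnessLib

/-!
# Varah's bound `σ_min(A) ≥ √(α β)` for matrices strictly diagonally dominant by rows and columns

Topic `Literature/LinearAlgebra/Matrix`; support file (everything PROVED; no definitions; no named
facts). Sub-namespace `Varah`, continuing `…Matrix.VarahBound` (the `ℓ∞` half, `‖A⁻¹‖_∞ ≤ 1/α`).
Norms: the entrywise row/column-sum lemmas are norm-free; the singular-value statements use the
spectral norm (`open scoped Matrix.Norms.L2Operator`, `‖A‖ = ‖Matrix.toEuclideanCLM A‖`), as in the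
companion `…ResolventPerturbationL2`.

THE RESULT. Varah 1975 [Varah1975] (restated as "Theorem B" (4.4) in Varga's survey
[Varga1976MMatrixTheory, §4]; H-matrix generalisation ibid. Thm 3 (4.8)): if `A ∈ ℂ^{n×n}` and `Aᵀ`
are both strictly diagonally dominant, `α := minᵢ (|aᵢᵢ| − Σ_{j ≠ i} |aᵢⱼ|)` (row gaps) and
`β := minᵢ (|aᵢᵢ| − Σ_{j ≠ i} |aⱼᵢ|)` (column gaps), then the smallest singular value satisfies
`σ_n(A) := (‖A⁻¹‖₂)⁻¹ ≥ √(α β)`.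

Proof (Varah's): `‖A⁻¹‖_∞ ≤ 1/α` (Theorem A, `Varah.linfty_norm_inv_le_of_margin`) and, applied to
`Aᵀ`, `‖A⁻¹‖₁ = ‖(Aᵀ)⁻¹‖_∞ ≤ 1/β`; then `‖A⁻¹‖₂² ≤ ‖A⁻¹‖₁ ‖A⁻¹‖_∞` (Schur's test /
[GolubVanLoan2013, Cor. 2.3.2], [HornJohnson2013, §5.6]).

* ROW AND COLUMN SUMS OF THE INVERSE (norm-free statements a verifier can also use entrywise):
  margin `α` by rows ⇒ `Σⱼ ‖(A⁻¹)ᵢⱼ‖ ≤ α⁻¹` for every `i` (`sum_norm_inv_row_le_of_margin`);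
  margin `β` by columns ⇒ `Σᵢ ‖(A⁻¹)ᵢⱼ‖ ≤ β⁻¹` for every `j` (`sum_norm_inv_col_le_of_margin`,
  via `Matrix.transpose_nonsing_inv`).
* SCHUR'S TEST, spectral-norm packaging of the landed finite-sum inequality
  `Literature.Analysis.InnerProduct.sum_norm_sq_mulVec_le_of_norm_le_of_rowSum_colSum`:
  row sums `≤ R`, column sums `≤ C` ⇒ `‖M‖₂ ≤ √(R C)` (`l2_norm_le_sqrt_of_rowSum_colSum`; no sign
  hypotheses — the empty index type is handled).
* MARGIN FORM of Theorem B — the form a verifier uses (it checks `α ≤ |aᵢᵢ| − Σ_{j ≠ i} |aᵢⱼ|` and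
  `β ≤ |aⱼⱼ| − Σ_{i ≠ j} |aᵢⱼ|` row by row / column by column in rational or interval arithmetic and
  never inverts `A` or computes an SVD): `A` is invertible and `‖A⁻¹‖₂ ≤ (√(α β))⁻¹`
  (`l2_norm_inv_le_of_margins`).
* VECTOR FORM `√(α β) ‖x‖₂ ≤ ‖A x‖₂` (`l2_sqrt_mul_norm_le_norm_mulVec`: the certified inequality
  `σ_min(A) ≥ √(α β)`), and the a-posteriori residual bound `‖x − x̃‖₂ ≤ (√(α β))⁻¹ ‖b − A x̃‖₂` for
  `A x = b` (`l2_norm_sub_le_of_margins`).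
* LITERAL FORM with `α`, `β` the minima of the row / column gaps over the (nonempty) index set
  (`l2_norm_inv_le_inv_sqrt_inf_gaps`), Varga's (4.2), (4.4) verbatim.

RELATION TO THE TREE (dedup). Not a restatement of anything landed. The Schur-test INEQUALITY itself
is already in the tree as a finite-sum statement
(`…InnerProduct.sum_norm_sq_mulVec_le_of_norm_le_of_rowSum_colSum`, [HornJohnson2013, §5.6]; special
cases `…Analysis.Matrix.sum_norm_sq_mulVec_le_of_rowSum_le_of_colSum_le` over `ℂ`,
`…Balaban1983to89.….l2_opNorm_le_of_rowSum_colSum_le` over `ℝ` with `R = C`) and is USED, not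
re-proved: `l2_norm_le_sqrt_of_rowSum_colSum` is only its `Matrix.Norms.L2Operator` packaging.
Nearest `σ_min` statements: `…Matrix.Resolvent.l2_mul_norm_le_norm_mulVec_of_posSemidef`
(`…ResolventPerturbationL2`: `s ‖x‖ ≤ ‖U x‖` from a positive-semidefiniteness certificate
`Uᴴ U − s² 1 ⪰ 0`, a different hypothesis) and the `ℓ∞` file `…Matrix.VarahBound` (Theorem A only;
its docstring lists Theorem B as NOT TYPED — this file types it).

NOT TYPED here: Varga's H-matrix generalisations `sup_{B ∈ Ω_A} ‖B⁻¹‖_∞ = ‖𝓜(A)⁻¹‖_∞` and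
`σ_n(A) ≥ {f_A(u) f_{Aᵀ}(v)}^{1/2}` ([Varga1976MMatrixTheory, Thm 2 (4.7), Thm 3 (4.8)]); the
interpolation form `‖M‖₂² ≤ ‖M‖₁ ‖M‖_∞` as an identity between three scoped matrix norms (only the
row-sum / column-sum form is stated).

References:
* J. M. Varah, *A lower bound for the smallest singular value of a matrix*, Linear Algebra Appl. 11
  (1975) 3–5. [Varah1975]
* R. S. Varga, *M-matrix theory and recent results in numerical linear algebra*, in: Sparse Matrix
  Computations (J. R. Bunch, D. J. Rose, eds.), Academic Press, 1976, §4 "On bounding ‖A⁻¹‖_∞",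
  Theorems A, B (4.4), 2, 3, p. 265–266. [Varga1976MMatrixTheory]
* G. H. Golub, C. F. Van Loan, *Matrix Computations*, 4th ed., Johns Hopkins 2013, §2.3.3
  Corollary 2.3.2 (`‖A‖₂ ≤ √(‖A‖₁ ‖A‖_∞)`), p. 80. [GolubVanLoan2013]
* R. A. Horn, C. R. Johnson, *Matrix Analysis*, 2nd ed., Cambridge 2013, §5.6. [HornJohnson2013]
-/

open Matrix WithLp

namespace Literature.LinearAlgebra.Matrix.Varah

/-! ### Row and column sums of `A⁻¹` -/

section InverseSums

open scoped _root_.Matrix.Norms.Operator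

variable {K : Type*} [NontriviallyNormedField K] [NormedAlgebra ℝ K] {n : Type*} [Fintype n]
  [DecidableEq n]

omit [NormedAlgebra ℝ K] in
/-- A row sum of entry norms is at most the `ℓ∞` operator ("max row sum") norm. [folklore] -/
private theorem sum_norm_le_linfty_norm (M : Matrix n n K) (i : n) : ∑ j, ‖M i j‖ ≤ ‖M‖ := by
  have h : (∑ j, ‖M i j‖₊) ≤ ‖M‖₊ := by
    rw [linfty_opNNNorm_def]
    exact Finset.le_sup (f := fun k => ∑ j, ‖M k j‖₊) (Finset.mem_univ i)
  have h' : ((∑ j, ‖M i j‖₊ : NNReal) : ℝ) ≤ (‖M‖₊ : ℝ) := NNReal.coe_le_coe.mpr h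
  simpa only [NNReal.coe_sum, coe_nnnorm] using h'

/-- **Row sums of the inverse**: if every row of `A` has dominance margin at least `α > 0`
(`α + Σ_{j ≠ i} ‖aᵢⱼ‖ ≤ ‖aᵢᵢ‖`), then every absolute row sum of `A⁻¹` is at most `α⁻¹`
(from `‖A⁻¹‖_∞ ≤ α⁻¹`).
[cite: Varah1975, the bound ‖A⁻¹‖_∞ ≤ 1/α] [cite: Varga1976MMatrixTheory, §4 Thm A (4.3)] -/
theorem sum_norm_inv_row_le_of_margin {A : Matrix n n K} {α : ℝ} (hα : 0 < α)
    (hrow : ∀ i, α + ∑ j ∈ Finset.univ.erase i, ‖A i j‖ ≤ ‖A i i‖) (i : n) :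
    ∑ j, ‖A⁻¹ i j‖ ≤ α⁻¹ :=
  (sum_norm_le_linfty_norm A⁻¹ i).trans (linfty_norm_inv_le_of_margin hα hrow).2

/-- **Column sums of the inverse**: if every column of `A` has dominance margin at least `β > 0`
(`β + Σ_{i ≠ j} ‖aᵢⱼ‖ ≤ ‖aⱼⱼ‖`, i.e. `Aᵀ` has row margin `β`), then every absolute column sum of
`A⁻¹` is at most `β⁻¹` (`‖A⁻¹‖₁ = ‖(Aᵀ)⁻¹‖_∞ ≤ β⁻¹`, `(Aᵀ)⁻¹ = (A⁻¹)ᵀ`).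
[cite: Varah1975, proof of the bound σ_n(A) ≥ √(αβ)]
[cite: Varga1976MMatrixTheory, §4 Thm B (4.4)] -/
theorem sum_norm_inv_col_le_of_margin {A : Matrix n n K} {β : ℝ} (hβ : 0 < β)
    (hcol : ∀ j, β + ∑ i ∈ Finset.univ.erase j, ‖A i j‖ ≤ ‖A j j‖) (j : n) :
    ∑ i, ‖A⁻¹ i j‖ ≤ β⁻¹ := by
  have h := sum_norm_inv_row_le_of_margin (A := Aᵀ) hβ
    (fun i => by simpa only [transpose_apply] using hcol i) j
  simpa only [← transpose_nonsing_inv, transpose_apply] using h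

end InverseSums

/-! ### Schur's test in the spectral norm and Varah's `σ_min` bound -/

section SingularValue

open scoped _root_.Matrix.Norms.L2Operator

variable {K : Type*} [RCLike K] {n : Type*} [Fintype n] [DecidableEq n]

/-- **Schur's test**, spectral-norm form: if every absolute row sum of `M` is `≤ R` and every
absolute column sum is `≤ C`, then `‖M‖₂ ≤ √(R C)` (Golub–Van Loan Cor. 2.3.2:
`‖A‖₂ ≤ √(‖A‖₁ ‖A‖_∞)`). The inequality is the landed finite-sum lemma
`Literature.Analysis.InnerProduct.sum_norm_sq_mulVec_le_of_norm_le_of_rowSum_colSum`; this is its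
operator-norm packaging. [cite: GolubVanLoan2013, §2.3.3 Cor 2.3.2] [cite: HornJohnson2013, §5.6] -/
theorem l2_norm_le_sqrt_of_rowSum_colSum (M : Matrix n n K) {R C : ℝ}
    (hrow : ∀ i, ∑ j, ‖M i j‖ ≤ R) (hcol : ∀ j, ∑ i, ‖M i j‖ ≤ C) : ‖M‖ ≤ √(R * C) := by
  rcases isEmpty_or_nonempty n with hn | hn
  · rw [Subsingleton.elim M 0, norm_zero]; exact Real.sqrt_nonneg _
  obtain ⟨i₀⟩ := hn
  have hR : 0 ≤ R := (Finset.sum_nonneg fun j _ => norm_nonneg (M i₀ j)).trans (hrow i₀)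
  have hC : 0 ≤ C := (Finset.sum_nonneg fun i _ => norm_nonneg (M i i₀)).trans (hcol i₀)
  rw [← l2_opNorm_toEuclideanCLM]
  refine ContinuousLinearMap.opNorm_le_bound _ (Real.sqrt_nonneg _) fun x => ?_
  rw [← sq_le_sq₀ (norm_nonneg _) (by positivity), mul_pow, Real.sq_sqrt (by positivity),
    EuclideanSpace.norm_sq_eq (toEuclideanCLM (n := n) (𝕜 := K) M x), EuclideanSpace.norm_sq_eq x]
  have hTi : ∀ i, (toEuclideanCLM (n := n) (𝕜 := K) M x) i = (M *ᵥ ofLp x) i := fun i => rfl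
  simp only [hTi]
  exact Literature.Analysis.InnerProduct.sum_norm_sq_mulVec_le_of_norm_le_of_rowSum_colSum
    (M := M) (Δ := fun i j => ‖M i j‖) (fun i j => le_rfl) hR hrow hcol (ofLp x)

/-- **Varah's bound, margin form** (Varga's Theorem B): if every row of `A` has dominance margin
at least `α > 0` and every column at least `β > 0`, then `A` is invertible and
`‖A⁻¹‖₂ ≤ 1/√(α β)`, i.e. `σ_min(A) ≥ √(α β)`.
[cite: Varah1975, the bound σ_n(A) ≥ √(αβ)] [cite: Varga1976MMatrixTheory, §4 Thm B (4.4)] -/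
theorem l2_norm_inv_le_of_margins {A : Matrix n n K} {α β : ℝ} (hα : 0 < α) (hβ : 0 < β)
    (hrow : ∀ i, α + ∑ j ∈ Finset.univ.erase i, ‖A i j‖ ≤ ‖A i i‖)
    (hcol : ∀ j, β + ∑ i ∈ Finset.univ.erase j, ‖A i j‖ ≤ ‖A j j‖) :
    IsUnit A.det ∧ ‖A⁻¹‖ ≤ (√(α * β))⁻¹ := by
  refine ⟨isUnit_det_of_margin hα hrow, ?_⟩
  have h := l2_norm_le_sqrt_of_rowSum_colSum A⁻¹ (sum_norm_inv_row_le_of_margin hα hrow)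
    (sum_norm_inv_col_le_of_margin hβ hcol)
  rwa [← mul_inv, Real.sqrt_inv] at h

/-- **Vector form** (the certified inequality `σ_min(A) ≥ √(α β)`): with row margin `α > 0` and
column margin `β > 0`, `√(α β) ‖x‖₂ ≤ ‖A x‖₂` for every `x`.
[cite: Varah1975, the bound σ_n(A) ≥ √(αβ)] [cite: Varga1976MMatrixTheory, §4 Thm B (4.4)] -/
theorem l2_sqrt_mul_norm_le_norm_mulVec {A : Matrix n n K} {α β : ℝ} (hα : 0 < α) (hβ : 0 < β)
    (hrow : ∀ i, α + ∑ j ∈ Finset.univ.erase i, ‖A i j‖ ≤ ‖A i i‖)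
    (hcol : ∀ j, β + ∑ i ∈ Finset.univ.erase j, ‖A i j‖ ≤ ‖A j j‖) (x : EuclideanSpace K n) :
    √(α * β) * ‖x‖ ≤ ‖(toLp 2 (A *ᵥ x) : EuclideanSpace K n)‖ := by
  obtain ⟨hU, hinv⟩ := l2_norm_inv_le_of_margins hα hβ hrow hcol
  have hs : 0 < √(α * β) := Real.sqrt_pos.2 (mul_pos hα hβ)
  have h1 := l2_opNorm_mulVec A⁻¹ (toLp 2 (A *ᵥ x) : EuclideanSpace K n)
  rw [ofLp_toLp, mulVec_mulVec, nonsing_inv_mul A hU, one_mulVec, toLp_ofLp] at h1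
  calc √(α * β) * ‖x‖ ≤ √(α * β) * (‖A⁻¹‖ * ‖(toLp 2 (A *ᵥ x) : EuclideanSpace K n)‖) :=
        mul_le_mul_of_nonneg_left h1 hs.le
    _ ≤ √(α * β) * ((√(α * β))⁻¹ * ‖(toLp 2 (A *ᵥ x) : EuclideanSpace K n)‖) :=
        mul_le_mul_of_nonneg_left (mul_le_mul_of_nonneg_right hinv (norm_nonneg _)) hs.le
    _ = ‖(toLp 2 (A *ᵥ x) : EuclideanSpace K n)‖ := by
        rw [← mul_assoc, mul_inv_cancel₀ hs.ne', one_mul]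

/-- **A-posteriori residual bound** in `ℓ²` for `A x = b` with `A` SDD by rows and columns:
`‖x − x̃‖₂ ≤ (√(α β))⁻¹ ‖b − A x̃‖₂`. [cite: Varga1976MMatrixTheory, §4 Thm B (4.4)] -/
theorem l2_norm_sub_le_of_margins {A : Matrix n n K} {α β : ℝ} (hα : 0 < α) (hβ : 0 < β)
    (hrow : ∀ i, α + ∑ j ∈ Finset.univ.erase i, ‖A i j‖ ≤ ‖A i i‖)
    (hcol : ∀ j, β + ∑ i ∈ Finset.univ.erase j, ‖A i j‖ ≤ ‖A j j‖) {x b : n → K}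
    (hx : A *ᵥ x = b) (y : n → K) :
    ‖(toLp 2 (x - y) : EuclideanSpace K n)‖ ≤
      (√(α * β))⁻¹ * ‖(toLp 2 (b - A *ᵥ y) : EuclideanSpace K n)‖ := by
  have hs : 0 < √(α * β) := Real.sqrt_pos.2 (mul_pos hα hβ)
  have h := l2_sqrt_mul_norm_le_norm_mulVec hα hβ hrow hcol (toLp 2 (x - y) : EuclideanSpace K n)
  rw [ofLp_toLp, mulVec_sub, hx] at h
  rwa [le_inv_mul_iff₀ hs]

/-- **Varah's bound, literal form** (Varga's (4.2), (4.4) verbatim): if `A` and `Aᵀ` are strictly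
diagonally dominant, then with `α := minᵢ (‖aᵢᵢ‖ − Σ_{j ≠ i} ‖aᵢⱼ‖)` and
`β := minⱼ (‖aⱼⱼ‖ − Σ_{i ≠ j} ‖aᵢⱼ‖)` (minima over the nonempty index set),
`‖A⁻¹‖₂ ≤ (√(α β))⁻¹`. [cite: Varah1975, the bound σ_n(A) ≥ √(αβ)]
[cite: Varga1976MMatrixTheory, §4 Thm B (4.2), (4.4)] -/
theorem l2_norm_inv_le_inv_sqrt_inf_gaps [Nonempty n] {A : Matrix n n K}
    (hrow : ∀ i, ∑ j ∈ Finset.univ.erase i, ‖A i j‖ < ‖A i i‖)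
    (hcol : ∀ j, ∑ i ∈ Finset.univ.erase j, ‖A i j‖ < ‖A j j‖) :
    IsUnit A.det ∧
      ‖A⁻¹‖ ≤ (√((Finset.univ.inf' Finset.univ_nonempty
          fun i => ‖A i i‖ - ∑ j ∈ Finset.univ.erase i, ‖A i j‖) *
        (Finset.univ.inf' Finset.univ_nonempty
          fun j => ‖A j j‖ - ∑ i ∈ Finset.univ.erase j, ‖A i j‖)))⁻¹ := by
  set α := Finset.univ.inf' Finset.univ_nonempty
    fun i => ‖A i i‖ - ∑ j ∈ Finset.univ.erase i, ‖A i j‖ with hα_def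
  set β := Finset.univ.inf' Finset.univ_nonempty
    fun j => ‖A j j‖ - ∑ i ∈ Finset.univ.erase j, ‖A i j‖ with hβ_def
  have hα : 0 < α := by
    rw [hα_def, Finset.lt_inf'_iff]
    intro i _; linarith [hrow i]
  have hβ : 0 < β := by
    rw [hβ_def, Finset.lt_inf'_iff]
    intro j _; linarith [hcol j]
  have hrow' : ∀ i, α + ∑ j ∈ Finset.univ.erase i, ‖A i j‖ ≤ ‖A i i‖ := by
    intro i
    have : α ≤ ‖A i i‖ - ∑ j ∈ Finset.univ.erase i, ‖A i j‖ :=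
      Finset.inf'_le _ (Finset.mem_univ i)
    linarith
  have hcol' : ∀ j, β + ∑ i ∈ Finset.univ.erase j, ‖A i j‖ ≤ ‖A j j‖ := by
    intro j
    have : β ≤ ‖A j j‖ - ∑ i ∈ Finset.univ.erase j, ‖A i j‖ :=
      Finset.inf'_le _ (Finset.mem_univ j)
    linarith
  exact l2_norm_inv_le_of_margins hα hβ hrow' hcol'

end SingularValue

end Literature.LinearAlgebra.Matrix.Varah
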